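import Summits.AtomisticToContinuum.Crystallization.Theorems.PalmUnimodularRigidityLayeredLawsSelectHcpRootEnergyChart
import Literature.MathematicalPhysics.StatisticalMechanics.TwoScaleShellSums

/-!
# Crux `LayeredLawsSelectHcp` (stmt-AtomisticToContinuum-9226), line `mtp-prestress-split-ergodic-frame`:
# the hard-core far tail of the root energy (ε-family)

Registered stubs `sum_inv_pow_six_tail_le` and `tube_farTail` of the far-field plan
(`Cruxes/LayeredLawsSelectHcp/LeadC3FarField.md`, §14 (1): "the tail is free").  The far field of the
rigidity certificate is certified as an `ε`-FAMILY: everything beyond Euclidean radius `R` of the root is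
bounded ABSOLUTELY by a hard-core shell-counting tail that tends to `0` as `R → ∞`.

* `sum_inv_pow_six_tail_le` — the `R`-dependent version of the shell sum
  `LennardJonesClusters.sum_inv_pow_six_le`: in an `r`-separated configuration, the partners of `xᵢ` at
  distance `≥ R ≥ 2r` contribute `∑ |xᵢ - x_k|⁻⁶ ≤ 750 r⁻⁴ R⁻²`.  It is the two-scale shell sum
  `TwoScaleShellSums.sum_inv_pow_six_le_two_scale` (`≤ 250 r⁻³ R⁻³`: shells of width `R`, packing by
  volume at scale `r`) applied to the image of the far index set, and `R⁻¹ ≤ r⁻¹`.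
* `tube_farTail` — the form the certificate consumes: for an every-point-good carrier `S` (hard core
  `891/1000`, `goodShell_separated`) and every finite family `T ⊆ S` of atoms of norm `≥ R ≥ 2`,
  `∑_{y ∈ T} |V_LJ(‖y‖)| ≤ 2400 R⁻²` (uniformly in `T`, whence the `tsum` / integral bound downstream),
  by `TwoScaleShellSums.sum_abs_lennardJones_le_two_scale` about the external centre `0` and the numerics
  `((1000/891)⁶/12 + 1/6) · 250 · (1000/891)³ ≤ 2400`, `R⁻³ ≤ R⁻²`.

All `[folklore]`.
-/

namespace Summit.AtomisticToContinuum.Crystallization.Theorems.PalmUnimodularRigidity.LayeredLawsSelectHcp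

open MeasureTheory Literature.MathematicalPhysics.StatisticalMechanics Literature.Geometry.DiscreteGeometry
open Summit.AtomisticToContinuum.Crystallization.Theorems.LayeredLawsSelectHcp.Negative.DiracLaws (GoodShell)

/-- **Far tail of the shell sum.** If all mutual distances in the configuration `x` (in `ℝ³`) are
`≥ r > 0` and `R ≥ 2r`, then the partners of `xᵢ` at distance `≥ R` satisfy
`∑ |xᵢ - x_k|⁻⁶ ≤ 750 · r⁻⁴ · R⁻²` (in fact `≤ 250 r⁻³ R⁻³`: the shell `⌊|xᵢ - x_k| / R⌋ = b ≥ 1` holds at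
most `125 b³ (R/r)³` particles by the packing bound, each contributing `≤ (b R)⁻⁶`, `∑_{b ≥ 1} b⁻³ ≤ 2`, and
`R⁻¹ ≤ r⁻¹`). [folklore] -/
theorem sum_inv_pow_six_tail_le : ∀ {N : ℕ} (x : Fin N → EuclideanSpace ℝ (Fin 3)) {r R : ℝ}, 0 < r → 2 * r ≤ R → (∀ k l, k ≠ l → r ≤ dist (x k) (x l)) → ∀ i : Fin N, ∑ k ∈ (Finset.univ.erase i).filter (fun k => R ≤ dist (x i) (x k)), (dist (x i) (x k))⁻¹ ^ 6 ≤ 750 * r⁻¹ ^ 4 * R⁻¹ ^ 2 := by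
  intro N x r R hr hrR hsep i
  set s := (Finset.univ.erase i).filter (fun k => R ≤ dist (x i) (x k)) with hs_def
  have hR : r ≤ R := by linarith
  have hR0 : 0 < R := by linarith
  -- `x` is injective on `s` (separated points are distinct)
  have hinj : ∀ k ∈ s, ∀ l ∈ s, x k = x l → k = l := fun k _ l _ hkl => by
    by_contra hne
    have h := hsep k l hne
    rw [hkl, dist_self] at h
    exact absurd h (not_le.2 hr)
  have hsepT : ∀ c ∈ s.image x, ∀ d ∈ s.image x, c ≠ d → r ≤ dist c d := by
    intro c hc d hd hne
    obtain ⟨k, -, rfl⟩ := Finset.mem_image.1 hc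
    obtain ⟨l, -, rfl⟩ := Finset.mem_image.1 hd
    exact hsep k l fun h => hne (h ▸ rfl)
  have hfarT : ∀ c ∈ s.image x, R ≤ dist (x i) c := by
    intro c hc
    obtain ⟨k, hk, rfl⟩ := Finset.mem_image.1 hc
    exact (Finset.mem_filter.1 hk).2
  -- the two-scale shell sum about the centre `xᵢ`, re-indexed through `x`
  have key := sum_inv_pow_six_le_two_scale (s.image x) (x i) hr hR hsepT hfarT
  rw [Finset.sum_image hinj] at key
  refine key.trans ?_
  -- `250 r⁻³ R⁻³ ≤ 750 r⁻⁴ R⁻²`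
  have h1 : R⁻¹ ≤ r⁻¹ := inv_anti₀ hr hR
  have h2 : 0 ≤ r⁻¹ ^ 3 * R⁻¹ ^ 2 := by positivity
  calc 250 * r⁻¹ ^ 3 * R⁻¹ ^ 3 = 250 * (r⁻¹ ^ 3 * R⁻¹ ^ 2) * R⁻¹ := by ring
    _ ≤ 750 * (r⁻¹ ^ 3 * R⁻¹ ^ 2) * r⁻¹ := mul_le_mul (by nlinarith) h1 (by positivity) (by positivity)
    _ = 750 * r⁻¹ ^ 4 * R⁻¹ ^ 2 := by ring

/-- **Registered sub-goal `tube_farTail` (the hard-core far tail of the `ε`-family).**  For an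
every-point-good carrier `S ⊆ ℝ³` and every finite family `T ⊆ S` of atoms of norm `≥ R ≥ 2`,
`∑_{y ∈ T} |V_LJ(‖y‖)| ≤ 2400 · R⁻²`, uniformly in `T`: the points of `S` are `891/1000`-separated
(`goodShell_separated`), so the two-scale Lennard-Jones shell sum about the external centre `0` gives
`≤ ((1000/891)⁶/12 + 1/6) · 250 · (1000/891)³ · R⁻³ ≤ 2400 R⁻²`. [folklore] -/
theorem tube_farTail : ∀ S : Set (EuclideanSpace ℝ (Fin 3)), (∀ x ∈ S, GoodShell S x) → ∀ R : ℝ, 2 ≤ R → ∀ T : Finset (EuclideanSpace ℝ (Fin 3)), (↑T : Set (EuclideanSpace ℝ (Fin 3))) ⊆ S → (∀ y ∈ T, R ≤ ‖y‖) → ∑ y ∈ T, |lennardJones ‖y‖| ≤ 2400 * R⁻¹ ^ 2 := by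
  intro S hS R hR T hTS hfar
  have hη : (0 : ℝ) < 891 / 1000 := by norm_num
  have hηR : (891 / 1000 : ℝ) ≤ R := by linarith
  have hsep : ∀ z ∈ T, ∀ w ∈ T, z ≠ w → (891 / 1000 : ℝ) ≤ dist z w :=
    fun z hz w hw hne => goodShell_separated hS z (hTS hz) w (hTS hw) hne
  have hfar' : ∀ z ∈ T, R ≤ dist (0 : EuclideanSpace ℝ (Fin 3)) z :=
    fun z hz => by rw [dist_zero_left]; exact hfar z hz
  have h := sum_abs_lennardJones_le_two_scale T 0 hη hηR hsep hfar'
  simp only [dist_zero_left] at h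
  refine h.trans ?_
  -- numerics: `((1000/891)⁶/12 + 1/6) · 250 · (1000/891)³ · R⁻³ ≤ 2400 · R⁻²`
  have hR0 : 0 < R := by linarith
  have hRinv0 : 0 ≤ R⁻¹ := by positivity
  have hRinv1 : R⁻¹ ≤ 1 := inv_le_one_of_one_le₀ (by linarith)
  have h3 : R⁻¹ ^ 3 ≤ R⁻¹ ^ 2 := pow_le_pow_of_le_one hRinv0 hRinv1 (by norm_num)
  have hC : ((891 / 1000 : ℝ)⁻¹ ^ 6 / 12 + 1 / 6) * (250 * (891 / 1000 : ℝ)⁻¹ ^ 3) ≤ 2400 := by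
    norm_num
  calc ((891 / 1000 : ℝ)⁻¹ ^ 6 / 12 + 1 / 6) * (250 * (891 / 1000 : ℝ)⁻¹ ^ 3 * R⁻¹ ^ 3)
      = ((891 / 1000 : ℝ)⁻¹ ^ 6 / 12 + 1 / 6) * (250 * (891 / 1000 : ℝ)⁻¹ ^ 3) * R⁻¹ ^ 3 := by ring
    _ ≤ 2400 * R⁻¹ ^ 2 := mul_le_mul hC h3 (by positivity) (by norm_num)

end Summit.AtomisticToContinuum.Crystallization.Theorems.PalmUnimodularRigidity.LayeredLawsSelectHcp
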